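import Summits.QuantumFields.BalabanUV.T4Continuum.Support.NE7CornerGaugeInterpolation
import Summits.QuantumFields.BalabanUV.T4Continuum.Support.NE3CpushGaugeCovariance
import HarnessLib

/-!
# T⁴ programme, row NE7 — (154f) RE-GAUGING THE REPRESENTATIVE TO A FLAT TOP: `u := w·u₀` with the corner-gauge
# interpolant `w` of `z ↦ u₀(Mz)⁻¹` gives `u|_{M•ℤ^d} = 1`, hence `cavgIter L (k+1) (U^u) = 1` — THE END's `hflatTop` —
# with the representative's currencies degraded by `O(ω)` only (`NE7CornerGaugeRegauge`)

Cell `pub-balaban`, lineage `t4-ne7-p2` (CRUX PROVER NE7 #2), gen 86; consumer of the kernel chain (154a–e) (road (β′) of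
PRICING-NE7 §419 ∕ `g85/HFLATTOP-MEMO.md` §4).  SETTING = THE END's REP♭ clauses (F54 v3∕v4 `smallField_of_trivialLetters_*`):
a `U(n)`-valued background `U` in the multi-level small-field class with FLAT TOP `cavgIter L (k+1) U = 1`, a unitary
`M·N`-periodic gauge `u₀` (`M = L^{k+1}`) with `U^{u₀} = vary 1 A₀ 1`, `A₀` `M·N`-periodic (skewness not needed), `‖A₀‖ ≤ a₀`,
`‖A₀(y+e_τ)κ − A₀ y κ‖ ≤ a₁`, and the CORNER OSCILLATION `‖u₀(M(z+e_i)) − u₀(Mz)‖ ≤ ω` of the gauge ((153) §5's letter: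
the top of `U^{u₀}` is `u₀(Mz)u₀(M(z+e_κ))⁻¹`, which is NOT `1` in general — this is why F52∕F53∕F54 carry `hflatTop` as a
hypothesis).  THIS FILE: with `w` from (154e) for the coarse data `v z := u₀(Mz)⁻¹` (threshold `300·d·ω ≤ 1`), the gauge
`u := w·u₀` satisfies `u(Mz) = 1`, so by the covariance of the iterated average (`NE3CpushGaugeCovariance.cavgIter_gaugeAct`)
`cavgIter L (k+1) (U^u) = (cavgIter L (k+1) U)^{u∘M•} = 1^{1} = 1`; and `U^u = vary 1 A 1` with `A := log (U^u)` skew,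
`M·N`-periodic, `‖A‖ ≤ 2(e^{a₀} − 1 + 8ω∕M)`, `‖A(y+e_τ)κ − A y κ‖ ≤ (4∕3)(e^{a₀}·a₁ + 2(8ω∕M)(e^{a₀} − 1) + 165ω∕M² + (8ω∕M)²)`
(provided `e^{a₀} − 1 + 8ω∕M ≤ 1∕4`).  So THE END may be fed `(u, A)` in place of `(u₀, A₀)`: `hflatTop` becomes a THEOREM,
at the price `α̂ ↦ ≈ 2.2α̂ + 16ω`, `α̂₁ ↦ ≈ (4∕3)(1.1α̂₁ + 18α̂ω + 165.3ω)` in F54's currencies (`a₀ = α̂∕M`, `a₁ = α̂₁∕M²`).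

HONEST FRAMING (page 1): [folklore] bookkeeping (logarithmic chart of the re-gauged links) + composition BY NAME over (154e)
and the tree's `cavgIter_gaugeAct`, `MatrixLog`; constants not optimised.  The data `(U, u₀, A₀, ω)` are HYPOTHESES (B8
Theorem 2 TYPE: REP♭ stays a hypothesis of THE END; only its `hflatTop` clause is discharged, given the corner oscillation
letter `ω`).  Nothing of Bałaban's is proved; (APE) NOT proved; THE END unfiled (the OWNER's F54); NE7 NOT PRINTED ∕ NOT
PROVED; spine 0∕9; finite T⁴ rung (B)+1 — NOT infinite volume, NOT mass gap, NOT Clay.  No `sorry`.  PLACEMENT: our lemma,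
under `Summits/QuantumFields/BalabanUV/`.
Continuum YM on T⁴ ⇐ BetaPertH ∧ nine spine estimates (0/9 proved); BetaPertH ⇐ (D1) ∧ (D4) ∧ CAP+tail; G-an2-4 gates asym, D1 and NE2/3/4.
-/

set_option autoImplicit false

open scoped BigOperators Matrix.Norms.L2Operator
open NormedSpace

namespace Summit.QuantumFields.BalabanUV.T4Continuum.NE7CornerGaugeRegauge

open Literature.MathematicalPhysics.QuantumFieldTheory.Balaban1983to89
open MatrixLog B7Prop1Explicit B7Prop2Explicit UnitaryRootInterpolation UnitaryGeodesic
open T4AveragingDeficitWall (IsUnitaryCfg IsSkewDir SmallField vary)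
open AveragingDeficitPeriodicCounting (IsPeriodicDir)
open AveragingDeficitMultiLevelPrep (cavgIter LevelSmall)
open BlockAveragePushDirSplit (flat)
open NE7GeodesicSecondOrder (norm_inv_sub_inv)
open NE7CornerGaugeInterpolation (exists_smooth_corner_gauge)

noncomputable section

variable {d : ℕ} {n : Type*} [Fintype n] [DecidableEq n] [Nonempty n]

/-- The re-gauged link is close to `1`: `‖b·E·p⁻¹ − 1‖ ≤ ‖E − 1‖ + ‖b − p‖` for unitaries `b, p`. [folklore] -/
theorem norm_link_sub_one_le {𝔸 : Type*} [CStarAlgebra 𝔸] {b p : 𝔸ˣ} (hb : b ∈ unitaryUnits 𝔸) (hp : p ∈ unitaryUnits 𝔸)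
    (E : 𝔸) : ‖(b : 𝔸) * E * ((p⁻¹ : 𝔸ˣ) : 𝔸) - 1‖ ≤ ‖E - 1‖ + ‖(b : 𝔸) - p‖ := by
  have hid : (b : 𝔸) * E * ((p⁻¹ : 𝔸ˣ) : 𝔸) - 1
      = (b : 𝔸) * (E - 1) * ((p⁻¹ : 𝔸ˣ) : 𝔸) + ((b : 𝔸) - p) * ((p⁻¹ : 𝔸ˣ) : 𝔸) := by
    simp only [mul_sub, sub_mul, mul_one, Units.mul_inv]; abel
  have hpi := (unitaryUnits 𝔸).inv_mem hp
  rw [hid]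
  refine (norm_add_le _ _).trans (add_le_add ?_ ?_)
  · rw [CStarRing.norm_mul_mem_unitary _ (mem_unitaryUnits.mp hpi), CStarRing.norm_mem_unitary_mul _ (mem_unitaryUnits.mp hb)]
  · rw [CStarRing.norm_mul_mem_unitary _ (mem_unitaryUnits.mp hpi)]

/-- **Gradient of the re-gauged links**: for unitaries `b = w(y)`, `a = w(y+e_τ)`, `p = w(y+e_κ)`, `q = w(y+e_τ+e_κ)` with
`‖a − b‖, ‖q − p‖ ≤ l`, second difference `‖q − a − p + b‖ ≤ σ`, and `‖E − 1‖ ≤ ε`, `‖E′ − E‖ ≤ η`: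
`‖a·E′·q⁻¹ − b·E·p⁻¹‖ ≤ η + 2·l·ε + σ + l²` — by the exact identity
`aE′q⁻¹ − bEp⁻¹ = a(E′−E)q⁻¹ + (aq⁻¹ − bp⁻¹) + ((a−b)(E−1)q⁻¹ + b(E−1)(q⁻¹−p⁻¹))`, `aq⁻¹ − bp⁻¹ = −(q−a−p+b)q⁻¹ + (b−p)(q⁻¹−p⁻¹)`.
[folklore] -/
theorem norm_link_sub_link_le {𝔸 : Type*} [CStarAlgebra 𝔸] [Nontrivial 𝔸] {a b p q : 𝔸ˣ}
    (ha : a ∈ unitaryUnits 𝔸) (hb : b ∈ unitaryUnits 𝔸) (hp : p ∈ unitaryUnits 𝔸) (hq : q ∈ unitaryUnits 𝔸)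
    {E E' : 𝔸} {l σ ε η : ℝ} (hab : ‖(a : 𝔸) - b‖ ≤ l) (hqp : ‖(q : 𝔸) - p‖ ≤ l) (hbp : ‖(b : 𝔸) - p‖ ≤ l)
    (hσ : ‖(q : 𝔸) - a - p + b‖ ≤ σ) (hE : ‖E - 1‖ ≤ ε) (hEE : ‖E' - E‖ ≤ η) :
    ‖(a : 𝔸) * E' * ((q⁻¹ : 𝔸ˣ) : 𝔸) - (b : 𝔸) * E * ((p⁻¹ : 𝔸ˣ) : 𝔸)‖ ≤ η + 2 * l * ε + σ + l ^ 2 := by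
  have hl0 : 0 ≤ l := (norm_nonneg _).trans hab
  have hε0 : 0 ≤ ε := (norm_nonneg _).trans hE
  have hqi := (unitaryUnits 𝔸).inv_mem hq
  have hpi := (unitaryUnits 𝔸).inv_mem hp
  have n1 : ∀ {u : 𝔸ˣ}, u ∈ unitaryUnits 𝔸 → ‖(u : 𝔸)‖ = 1 := fun hu => CStarRing.norm_of_mem_unitary (mem_unitaryUnits.mp hu)
  have hid : (a : 𝔸) * E' * ((q⁻¹ : 𝔸ˣ) : 𝔸) - (b : 𝔸) * E * ((p⁻¹ : 𝔸ˣ) : 𝔸)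
      = (a : 𝔸) * (E' - E) * ((q⁻¹ : 𝔸ˣ) : 𝔸)
        + (-(((q : 𝔸) - a - p + b) * ((q⁻¹ : 𝔸ˣ) : 𝔸)) + ((b : 𝔸) - p) * (((q⁻¹ : 𝔸ˣ) : 𝔸) - ((p⁻¹ : 𝔸ˣ) : 𝔸)))
        + (((a : 𝔸) - b) * (E - 1) * ((q⁻¹ : 𝔸ˣ) : 𝔸) + (b : 𝔸) * (E - 1) * (((q⁻¹ : 𝔸ˣ) : 𝔸) - ((p⁻¹ : 𝔸ˣ) : 𝔸))) := by
    have e1 : (q : 𝔸) * ((q⁻¹ : 𝔸ˣ) : 𝔸) = 1 := Units.mul_inv q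
    have e2 : (p : 𝔸) * ((p⁻¹ : 𝔸ˣ) : 𝔸) = 1 := Units.mul_inv p
    -- a pure ring identity after recording `q q⁻¹ = p p⁻¹ = 1`
    have : ((q : 𝔸) - a - p + b) * ((q⁻¹ : 𝔸ˣ) : 𝔸)
        = 1 - (a : 𝔸) * ((q⁻¹ : 𝔸ˣ) : 𝔸) - (p : 𝔸) * ((q⁻¹ : 𝔸ˣ) : 𝔸) + (b : 𝔸) * ((q⁻¹ : 𝔸ˣ) : 𝔸) := by
      rw [← e1]; noncomm_ring
    rw [this]
    have : ((b : 𝔸) - p) * (((q⁻¹ : 𝔸ˣ) : 𝔸) - ((p⁻¹ : 𝔸ˣ) : 𝔸))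
        = (b : 𝔸) * ((q⁻¹ : 𝔸ˣ) : 𝔸) - (b : 𝔸) * ((p⁻¹ : 𝔸ˣ) : 𝔸) - (p : 𝔸) * ((q⁻¹ : 𝔸ˣ) : 𝔸) + 1 := by
      rw [← e2]; noncomm_ring
    rw [this]
    noncomm_ring
  have hqp' : ‖((q⁻¹ : 𝔸ˣ) : 𝔸) - ((p⁻¹ : 𝔸ˣ) : 𝔸)‖ ≤ l := by rw [norm_inv_sub_inv hq hp]; exact hqp
  rw [hid]
  have t1 : ‖(a : 𝔸) * (E' - E) * ((q⁻¹ : 𝔸ˣ) : 𝔸)‖ ≤ η := by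
    rw [CStarRing.norm_mul_mem_unitary _ (mem_unitaryUnits.mp hqi), CStarRing.norm_mem_unitary_mul _ (mem_unitaryUnits.mp ha)]
    exact hEE
  have t2 : ‖-(((q : 𝔸) - a - p + b) * ((q⁻¹ : 𝔸ˣ) : 𝔸)) + ((b : 𝔸) - p) * (((q⁻¹ : 𝔸ˣ) : 𝔸) - ((p⁻¹ : 𝔸ˣ) : 𝔸))‖
      ≤ σ + l ^ 2 := by
    refine (norm_add_le _ _).trans (add_le_add ?_ ?_)
    · rw [norm_neg, CStarRing.norm_mul_mem_unitary _ (mem_unitaryUnits.mp hqi)]; exact hσ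
    · calc ‖((b : 𝔸) - p) * (((q⁻¹ : 𝔸ˣ) : 𝔸) - ((p⁻¹ : 𝔸ˣ) : 𝔸))‖
            ≤ ‖(b : 𝔸) - p‖ * ‖((q⁻¹ : 𝔸ˣ) : 𝔸) - ((p⁻¹ : 𝔸ˣ) : 𝔸)‖ := norm_mul_le _ _
        _ ≤ l * l := mul_le_mul hbp hqp' (norm_nonneg _) hl0
        _ = l ^ 2 := (sq l).symm
  have t3 : ‖((a : 𝔸) - b) * (E - 1) * ((q⁻¹ : 𝔸ˣ) : 𝔸) + (b : 𝔸) * (E - 1) * (((q⁻¹ : 𝔸ˣ) : 𝔸) - ((p⁻¹ : 𝔸ˣ) : 𝔸))‖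
      ≤ 2 * l * ε := by
    refine (norm_add_le _ _).trans ?_
    have u1 : ‖((a : 𝔸) - b) * (E - 1) * ((q⁻¹ : 𝔸ˣ) : 𝔸)‖ ≤ l * ε := by
      rw [CStarRing.norm_mul_mem_unitary _ (mem_unitaryUnits.mp hqi)]
      exact (norm_mul_le _ _).trans (mul_le_mul hab hE (norm_nonneg _) hl0)
    have u2 : ‖(b : 𝔸) * (E - 1) * (((q⁻¹ : 𝔸ˣ) : 𝔸) - ((p⁻¹ : 𝔸ˣ) : 𝔸))‖ ≤ ε * l := by
      rw [mul_assoc, CStarRing.norm_mem_unitary_mul _ (mem_unitaryUnits.mp hb)]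
      exact (norm_mul_le _ _).trans (mul_le_mul hE hqp' (norm_nonneg _) hε0)
    nlinarith
  calc _ ≤ ‖(a : 𝔸) * (E' - E) * ((q⁻¹ : 𝔸ˣ) : 𝔸)
          + (-(((q : 𝔸) - a - p + b) * ((q⁻¹ : 𝔸ˣ) : 𝔸)) + ((b : 𝔸) - p) * (((q⁻¹ : 𝔸ˣ) : 𝔸) - ((p⁻¹ : 𝔸ˣ) : 𝔸)))‖
        + ‖((a : 𝔸) - b) * (E - 1) * ((q⁻¹ : 𝔸ˣ) : 𝔸) + (b : 𝔸) * (E - 1) * (((q⁻¹ : 𝔸ˣ) : 𝔸) - ((p⁻¹ : 𝔸ˣ) : 𝔸))‖ :=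
        norm_add_le _ _
    _ ≤ (η + (σ + l ^ 2)) + 2 * l * ε := add_le_add ((norm_add_le _ _).trans (add_le_add t1 t2)) t3
    _ = η + 2 * l * ε + σ + l ^ 2 := by ring

/-- **RE-GAUGING TO A FLAT TOP.**  In the setting of THE END's REP♭ clauses (docstring above), with the corner oscillation
`‖u₀(M(z+e_i)) − u₀(Mz)‖ ≤ ω` of the gauge, `300·d·ω ≤ 1` and `e^{a₀} − 1 + 8ω∕M ≤ 1∕4` (`M = L^{k+1}`): there are a unitary
`M·N`-periodic gauge `u` and a skew `M·N`-periodic `A` with `U^u = vary 1 A 1`, `‖A‖ ≤ 2(e^{a₀} − 1 + 8ω∕M)`,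
`‖A(y+e_τ)κ − A y κ‖ ≤ (4∕3)(e^{a₀}a₁ + 2(8ω∕M)(e^{a₀} − 1) + 165ω∕M² + (8ω∕M)²)`, AND THE FLAT TOP
`cavgIter L (k+1) (vary 1 A 1) = 1` (`u := w·u₀`, `w` the corner-gauge interpolant (154e) of `z ↦ u₀(Mz)⁻¹`). [folklore] -/
theorem exists_regauge_flatTop {L : ℕ} (hL : 1 ≤ L) (k N : ℕ)
    {U : Site d → Fin d → (Matrix n n ℂ)ˣ} {x : ℝ} (hUu : IsUnitaryCfg U) (hx : 0 ≤ x) (hs : LevelSmall d L k x) (hUx : SmallField U x)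
    (hflatTopU : cavgIter L (k + 1) U = flat)
    {u₀ : Site d → (Matrix n n ℂ)ˣ} (hu₀ : ∀ y, u₀ y ∈ unitaryUnits (Matrix n n ℂ))
    (hu₀P : ∀ (y : Site d) (i : Fin d), u₀ (y + ((L ^ (k + 1) * N : ℕ) : ℤ) • e i) = u₀ y)
    {A₀ : Site d → Fin d → (Matrix n n ℂ)} (hgauge₀ : gaugeAct u₀ U = vary (flat (d := d) (n := n)) A₀ 1)
    (hA₀P : IsPeriodicDir A₀ ((L ^ (k + 1) * N : ℕ) : ℤ))
    {a₀ a₁ ω : ℝ} (ha₀ : ∀ (y : Site d) (κ : Fin d), ‖A₀ y κ‖ ≤ a₀)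
    (ha₁ : ∀ (y : Site d) (κ τ : Fin d), ‖A₀ (y + e τ) κ - A₀ y κ‖ ≤ a₁)
    (hω : ∀ (z : Site d) (i : Fin d), ‖(u₀ (((L : ℤ) ^ (k + 1)) • (z + e i)) : (Matrix n n ℂ)) - u₀ (((L : ℤ) ^ (k + 1)) • z)‖ ≤ ω)
    (hωd : 300 * (d : ℝ) * ω ≤ 1) (hβ : Real.exp a₀ - 1 + 8 * ω / (L : ℝ) ^ (k + 1) ≤ 1 / 4) :
    ∃ (u : Site d → (Matrix n n ℂ)ˣ) (A : Site d → Fin d → (Matrix n n ℂ)),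
      (∀ y, u y ∈ unitaryUnits (Matrix n n ℂ)) ∧
      (∀ (y : Site d) (i : Fin d), u (y + ((L ^ (k + 1) * N : ℕ) : ℤ) • e i) = u y) ∧
      gaugeAct u U = vary (flat (d := d) (n := n)) A 1 ∧ IsSkewDir A ∧ IsPeriodicDir A ((L ^ (k + 1) * N : ℕ) : ℤ) ∧
      (∀ (y : Site d) (κ : Fin d), ‖A y κ‖ ≤ 2 * (Real.exp a₀ - 1 + 8 * ω / (L : ℝ) ^ (k + 1))) ∧
      (∀ (y : Site d) (κ τ : Fin d), ‖A (y + e τ) κ - A y κ‖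
        ≤ 4 / 3 * (Real.exp a₀ * a₁ + 2 * (8 * ω / (L : ℝ) ^ (k + 1)) * (Real.exp a₀ - 1)
            + 165 * ω / ((L : ℝ) ^ (k + 1)) ^ 2 + (8 * ω / (L : ℝ) ^ (k + 1)) ^ 2)) ∧
      cavgIter L (k + 1) (vary (flat (d := d) (n := n)) A 1) = flat := by
  letI : CStarAlgebra (Matrix n n ℂ) := {}
  -- the block size `M = L^{k+1}` and its casts
  have hM : 1 ≤ L ^ (k + 1) := Nat.one_le_pow _ _ hL
  have hMz : ((L ^ (k + 1) : ℕ) : ℤ) = (L : ℤ) ^ (k + 1) := by push_cast; ring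
  have hMr : ((L ^ (k + 1) : ℕ) : ℝ) = (L : ℝ) ^ (k + 1) := by push_cast; ring
  have hT : ((L ^ (k + 1) * N : ℕ) : ℤ) = ((L ^ (k + 1) : ℕ) : ℤ) * N := by push_cast; ring
  -- the coarse data `v z = u₀(Mz)⁻¹` and its interpolant
  have hvU : ∀ z : Site d, (u₀ ((((L ^ (k + 1) : ℕ) : ℤ)) • z))⁻¹ ∈ unitaryUnits (Matrix n n ℂ) :=
    fun z => (unitaryUnits (Matrix n n ℂ)).inv_mem (hu₀ _)
  have hvP : ∀ (z : Site d) (i : Fin d),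
      (u₀ ((((L ^ (k + 1) : ℕ) : ℤ)) • (z + (N : ℤ) • e i)))⁻¹ = (u₀ ((((L ^ (k + 1) : ℕ) : ℤ)) • z))⁻¹ := by
    intro z i
    rw [smul_add, smul_smul, ← hT, hu₀P]
  have hvω : ∀ (z : Site d) (i : Fin d),
      ‖(((u₀ ((((L ^ (k + 1) : ℕ) : ℤ)) • (z + e i)))⁻¹ : (Matrix n n ℂ)ˣ) : (Matrix n n ℂ)) - (((u₀ ((((L ^ (k + 1) : ℕ) : ℤ)) • z))⁻¹ : (Matrix n n ℂ)ˣ) : (Matrix n n ℂ))‖ ≤ ω := by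
    intro z i
    rw [norm_inv_sub_inv (hu₀ _) (hu₀ _), hMz]
    exact hω z i
  obtain ⟨w, hwU, hwP, hwc, hw1, hw2⟩ :=
    exists_smooth_corner_gauge (𝔸 := (Matrix n n ℂ)) hM N hvU hvP hvω hωd
  -- the new gauge and its links
  refine ⟨fun y => w y * u₀ y, fun y μ => mlog ((gaugeAct (fun y => w y * u₀ y) U y μ : (Matrix n n ℂ)ˣ) : (Matrix n n ℂ)), fun y =>
    (unitaryUnits (Matrix n n ℂ)).mul_mem (hwU y) (hu₀ y), fun y i => by simp only [hwP, hu₀P], ?_⟩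
  -- the link variable: `(w·u₀) U (w·u₀)⁻¹ = w · (U^{u₀}) · w⁻¹ = w(y) e^{A₀(y,μ)} w(y+e_μ)⁻¹`
  have hlink : ∀ (y : Site d) (μ : Fin d), gaugeAct (fun y => w y * u₀ y) U y μ
      = w y * expUnit (A₀ y μ) * (w (y + e μ))⁻¹ := by
    intro y μ
    have h0 := congr_fun (congr_fun hgauge₀ y) μ
    simp only [gaugeAct, vary, flat, one_mul, Complex.ofReal_one, one_smul] at h0 ⊢
    rw [← h0, mul_inv_rev]
    simp only [mul_assoc]
  have hlinkU : ∀ (y : Site d) (μ : Fin d), gaugeAct (fun y => w y * u₀ y) U y μ ∈ unitaryUnits (Matrix n n ℂ) := by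
    intro y μ
    simp only [gaugeAct]
    exact (unitaryUnits (Matrix n n ℂ)).mul_mem ((unitaryUnits (Matrix n n ℂ)).mul_mem ((unitaryUnits (Matrix n n ℂ)).mul_mem (hwU _) (hu₀ _)) (hUu _ _))
      ((unitaryUnits (Matrix n n ℂ)).inv_mem ((unitaryUnits (Matrix n n ℂ)).mul_mem (hwU _) (hu₀ _)))
  -- sizes
  have hE1 : ∀ (y : Site d) (μ : Fin d), ‖((expUnit (A₀ y μ) : (Matrix n n ℂ)ˣ) : (Matrix n n ℂ)) - 1‖ ≤ Real.exp a₀ - 1 := fun y μ => by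
    rw [val_expUnit]; exact B7Transfer.norm_exp_sub_one_le_of_le _ (ha₀ y μ)
  have hw1' : ∀ (y : Site d) (μ : Fin d), ‖(w (y + e μ) : (Matrix n n ℂ)) - w y‖ ≤ 8 * ω / (L : ℝ) ^ (k + 1) := fun y μ => by
    rw [← hMr]; exact hw1 y μ
  have hw2' : ∀ (y : Site d) (μ τ : Fin d), ‖(w (y + e μ + e τ) : (Matrix n n ℂ)) - w (y + e τ) - w (y + e μ) + w y‖
      ≤ 165 * ω / ((L : ℝ) ^ (k + 1)) ^ 2 := fun y μ τ => by rw [← hMr]; exact hw2 y μ τ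
  have hnorm1 : ∀ (y : Site d) (μ : Fin d), ‖((gaugeAct (fun y => w y * u₀ y) U y μ : (Matrix n n ℂ)ˣ) : (Matrix n n ℂ)) - 1‖
      ≤ Real.exp a₀ - 1 + 8 * ω / (L : ℝ) ^ (k + 1) := by
    intro y μ
    rw [hlink, Units.val_mul, Units.val_mul]
    refine (norm_link_sub_one_le (hwU y) (hwU (y + e μ)) _).trans (add_le_add (hE1 y μ) ?_)
    rw [norm_sub_rev]; exact hw1' y μ
  have hβ1 : Real.exp a₀ - 1 + 8 * ω / (L : ℝ) ^ (k + 1) < 1 := by linarith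
  refine ⟨?_, ?_, ?_, ?_, ?_, ?_⟩
  · -- `U^u = vary 1 A 1` with `A = log (U^u)`
    funext y μ
    apply Units.ext
    simp only [vary, flat, one_mul, Complex.ofReal_one, one_smul, val_expUnit]
    rw [exp_mlog ((hnorm1 y μ).trans_lt hβ1)]
  · -- skew
    intro y μ
    have h := star_mlog_eq_neg (mem_unitaryUnits.mp (hlinkU y μ)) ((hnorm1 y μ).trans hβ)
    exact skewAdjoint.mem_iff.mpr h
  · -- periodic
    intro y κ μ
    simp only [hlink]
    rw [add_right_comm, hwP, hwP, hA₀P]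
  · -- size of `A`
    intro y μ
    exact (norm_mlog_le_two_mul ((hnorm1 y μ).trans (hβ.trans (by norm_num)))).trans (by linarith [hnorm1 y μ])
  · -- gradient of `A`
    intro y κ τ
    refine (NE7ExpLogSecondOrder.norm_mlog_sub_mlog_le_four_thirds hβ (hnorm1 _ _) (hnorm1 _ _)).trans
      (mul_le_mul_of_nonneg_left ?_ (by norm_num))
    rw [hlink, hlink, Units.val_mul, Units.val_mul, Units.val_mul, Units.val_mul]
    have hEE : ‖((expUnit (A₀ (y + e τ) κ) : (Matrix n n ℂ)ˣ) : (Matrix n n ℂ)) - ((expUnit (A₀ y κ) : (Matrix n n ℂ)ˣ) : (Matrix n n ℂ))‖ ≤ Real.exp a₀ * a₁ := by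
      rw [val_expUnit, val_expUnit]
      have h := Literature.Analysis.Complex.norm_exp_sub_exp_le (A₀ (y + e τ) κ) (A₀ y κ)
      have hm : Real.exp (max ‖A₀ (y + e τ) κ‖ ‖A₀ y κ‖) ≤ Real.exp a₀ := Real.exp_le_exp.mpr (max_le (ha₀ _ _) (ha₀ _ _))
      calc _ ≤ ‖A₀ (y + e τ) κ - A₀ y κ‖ * Real.exp (max ‖A₀ (y + e τ) κ‖ ‖A₀ y κ‖) := h
        _ ≤ a₁ * Real.exp a₀ := mul_le_mul (ha₁ y κ τ) hm (by positivity) ((norm_nonneg _).trans (ha₁ y κ τ))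
        _ = Real.exp a₀ * a₁ := mul_comm _ _
    have hq : ‖(w (y + e τ + e κ) : (Matrix n n ℂ)) - w (y + e κ)‖ ≤ 8 * ω / (L : ℝ) ^ (k + 1) := by
      have := hw1' (y + e κ) τ; rwa [add_right_comm] at this
    have hσ : ‖(w (y + e τ + e κ) : (Matrix n n ℂ)) - w (y + e τ) - w (y + e κ) + w y‖ ≤ 165 * ω / ((L : ℝ) ^ (k + 1)) ^ 2 := by
      have := hw2' y κ τ; rwa [add_right_comm y (e κ) (e τ)] at this
    have hbp : ‖(w y : (Matrix n n ℂ)) - w (y + e κ)‖ ≤ 8 * ω / (L : ℝ) ^ (k + 1) := by rw [norm_sub_rev]; exact hw1' y κ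
    have h := norm_link_sub_link_le (hwU (y + e τ)) (hwU y) (hwU (y + e κ)) (hwU (y + e τ + e κ))
      (E := ((expUnit (A₀ y κ) : (Matrix n n ℂ)ˣ) : (Matrix n n ℂ))) (E' := ((expUnit (A₀ (y + e τ) κ) : (Matrix n n ℂ)ˣ) : (Matrix n n ℂ)))
      (hw1' y τ) hq hbp hσ (hE1 y κ) hEE
    refine h.trans (le_of_eq ?_)
    ring
  · -- THE FLAT TOP: `cavgIter (U^u) = (cavgIter U)^{u ∘ M•} = flat^{1} = flat`
    have hgA : vary (flat (d := d) (n := n)) (fun y μ => mlog ((gaugeAct (fun y => w y * u₀ y) U y μ : (Matrix n n ℂ)ˣ) : (Matrix n n ℂ))) 1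
        = gaugeAct (fun y => w y * u₀ y) U := by
      funext y μ
      apply Units.ext
      simp only [vary, flat, one_mul, Complex.ofReal_one, one_smul, val_expUnit]
      rw [exp_mlog ((hnorm1 y μ).trans_lt hβ1)]
    have huU : ∀ y, (fun y => w y * u₀ y) y ∈ unitaryUnits (Matrix n n ℂ) := fun y => (unitaryUnits (Matrix n n ℂ)).mul_mem (hwU y) (hu₀ y)
    rw [hgA, NE3CpushGaugeCovariance.cavgIter_gaugeAct hL k hUu hx hs hUx huU, hflatTopU]
    have hcorner : ∀ z : Site d, w (((L : ℤ) ^ (k + 1)) • z) * u₀ (((L : ℤ) ^ (k + 1)) • z) = 1 := by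
      intro z
      rw [← hMz, hwc z, inv_mul_cancel]
    funext z μ
    simp only [gaugeAct, flat, hcorner, mul_one, inv_one]

end

end Summit.QuantumFields.BalabanUV.T4Continuum.NE7CornerGaugeRegauge
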